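import Literature.Topology.FourManifolds.ComplexProjectiveSpace
import Literature.AlgebraicTopology.FundamentalGroup.SphereSimplyConnected
import Mathlib.Geometry.Manifold.ContMDiff.Atlas
import Mathlib.Geometry.Manifold.ContMDiff.NormedSpace
import Mathlib.Analysis.Calculus.ContDiff.WithLp
import HarnessLib

/-!
# `ℂℙ¹ ≅ 𝕊²` and `π₁(ℂℙⁿ) = 1`: proofs of named facts of `ComplexProjectiveSpace.lean`

Sibling proof file of `ComplexProjectiveSpace.lean` (D-0014: named facts `def X : Prop` are
discharged as `theorem X_holds : X`). It discharges

* `Literature.nonempty_diffeomorph_complexProjectiveSpace_one_sphere_holds :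
    nonempty_diffeomorph_complexProjectiveSpace_one_sphere` — the complex projective line
  `Literature.ComplexProjectiveSpace 1` (real-analytic `2`-manifold through its two affine charts, model
  `EuclideanSpace ℝ (Fin (2 * 1))`) is diffeomorphic (`C^∞`) to the round sphere
  `𝕊² = Metric.sphere (0 : EuclideanSpace ℝ (Fin 3)) 1` with Mathlib's stereographic charts.
* `Literature.simplyConnectedSpace_complexProjectiveSpace_holds : simplyConnectedSpace_complexProjectiveSpace`
  — `ℂℙⁿ` is simply connected for every `n` (Milnor–Stasheff, §14, Thm. 14.4: CW structure with
  even-dimensional cells only; Hatcher, *Algebraic Topology*, Example 0.6), and its case `n = 2`,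
  `Literature.simplyConnectedSpace_complexProjectivePlane_holds : simplyConnectedSpace_complexProjectivePlane`.
  See the section `### Simple connectivity of ℂℙⁿ` at the end of the file for the source and the
  proof route (Hatcher's Lemma 1.15 applied to the affine cover).

## Source

P. Griffiths, J. Harris, *Principles of Algebraic Geometry*, Wiley (1978), Ch. 0 §2 (complex
manifolds; `ℙⁿ` with its affine charts `Uᵢ = {Zᵢ ≠ 0}`; `ℙ¹` is the Riemann sphere `ℂ ∪ {∞} = S²`);
J. Milnor, J. Stasheff, *Characteristic Classes* (1974), §14. The identification is folklore; the
printed argument is "the change of charts of `ℙ¹` is `z ↦ 1/z`, that of `S²` (stereographic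
projections from the two poles, one of them followed by a reflection) as well".

## Proof

We do not compare atlases (Mathlib's charts of `𝕊²` are stereographic projections followed by a
*non-explicit* linear isometry `(ℝ ∙ v)ᗮ ≃ₗᵢ ℝ²`); instead we write down the diffeomorphism and its
inverse in closed form and use only the two structural facts Mathlib offers about the sphere,
`contMDiff_coe_sphere` (the inclusion `𝕊² → ℝ³` is smooth) and `ContMDiff.codRestrict_sphere`
(a smooth map into `ℝ³` with values on `𝕊²` is smooth into `𝕊²`).

* The map `ℂℙ¹ → 𝕊²` is the **Hopf map** in homogeneous coordinates,
  `[v₀ : v₁] ↦ (2 Re(v₀ v̄₁), 2 Im(v₀ v̄₁), |v₀|² - |v₁|²) / (|v₀|² + |v₁|²)`,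
  well defined (`hopf_smul`), with values on the unit sphere (`norm_hopf`) and real-analytic on
  `ℂ² ∖ {0}` (`contDiffAt_hopf`). A map out of `ℂℙⁿ` is `C^m` as soon as its composites with the
  inverse affine charts are (`contMDiff_of_contDiff_comp_affineChart_symm`), and these composites
  are the Hopf map precomposed with the affine-linear homogenisation (`contMDiff_of_hopf`).
* The inverse `𝕊² → ℂℙ¹` is `(x, y, t) ↦ [1 + t : x - iy]` off the south pole `t = -1` and
  `(x, y, t) ↦ [x + iy : 1 - t]` off the north pole `t = 1`; the two agree on the overlap because
  `(1 + t)(1 - t) = x² + y² = (x - iy)(x + iy)` on the sphere (`affineChart_zero_symm_eq_one_symm`).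
  Each branch is an inverse affine chart (smooth on the whole model space,
  `contMDiff_affineChart_symm`) after a rational map of `ℝ³` restricted to the sphere, whence
  smoothness (`contMDiff_invHopf`).
* The two composites are the identity by direct computation in the affine charts
  (`hopf_affineChart_zero_symm`, `hopf_affineChart_one_symm`, `inv_hopf_hopf_of_eq_zero`,
  `inv_hopf_hopf_of_ne_zero`).

Design: this file only adds theorems (no auxiliary definitions, notation or instances). The Hopf
map `F : ℂℙ¹ → ℝ³`, its corestriction `f` to the sphere and the inverse `g` are built inside the
final proof (`Projectivization.lift`, `Set.codRestrict`, an `if` on the last coordinate); the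
auxiliary lemmas take them as variables `F`, `f`, `g` together with their defining equations
`hF`, `hf`, `hg`. Mathlib's `Fact (finrank ℝ (EuclideanSpace ℝ (Fin (2 + 1))) = 2 + 1)`, consumed
by its sphere API, is supplied inside the proofs by `haveI`, as Mathlib does in
`EuclideanSpace.instIsManifoldSphere`.
-/

open scoped Manifold ContDiff Topology ComplexConjugate
open Set Function Metric Module

namespace Literature.Topology.FourManifolds

namespace ComplexProjectiveSpace

variable {m : ℕ∞ω} {n : ℕ}

/-! #### Calculus on `ℂℙⁿ` through the affine charts -/

/-- A map out of `ℂℙⁿ` into a normed space is `C^m` as soon as its composites with the inverses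
of the `n + 1` affine charts are `C^m` maps `ℝ²ⁿ → E'` (the affine charts are `C^m` and cover
`ℂℙⁿ`; Griffiths–Harris, Ch. 0 §2). [folklore] -/
theorem contMDiff_of_contDiff_comp_affineChart_symm {E' : Type*} [NormedAddCommGroup E']
    [NormedSpace ℝ E'] {F : ComplexProjectiveSpace n → E'}
    (h : ∀ i, ContDiff ℝ m (F ∘ (affineChart i).symm)) :
    ContMDiff (𝓡 (2 * n)) 𝓘(ℝ, E') m F := by
  intro p
  have hp : p ∈ (affineChart (chartIndex p)).source := coordNeZero_chartIndex p
  have he : affineChart (chartIndex p) ∈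
      IsManifold.maximalAtlas (𝓡 (2 * n)) m (ComplexProjectiveSpace n) :=
    IsManifold.subset_maximalAtlas ⟨chartIndex p, rfl⟩
  have h1 : ContMDiffAt (𝓡 (2 * n)) (𝓡 (2 * n)) m (affineChart (chartIndex p)) p :=
    contMDiffAt_of_mem_maximalAtlas he hp
  have h2 : ContMDiff (𝓡 (2 * n)) 𝓘(ℝ, E') m (F ∘ (affineChart (chartIndex p)).symm) :=
    (h _).contMDiff
  refine (h2.contMDiffAt.comp p h1).congr_of_eventuallyEq ?_
  filter_upwards [(affineChart (chartIndex p)).open_source.mem_nhds hp] with q hq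
  simp only [comp_apply, (affineChart (chartIndex p)).left_inv hq]

/-- The inverse `w ↦ [w₀ : ⋯ : 1 : ⋯ : w_{n-1}]` of an affine chart of `ℂℙⁿ` is `C^m` on the whole
model space `ℝ²ⁿ` (its target), as the inverse of a chart of the `C^m` atlas. [folklore] -/
theorem contMDiff_affineChart_symm (i : Fin (n + 1)) :
    ContMDiff (𝓡 (2 * n)) (𝓡 (2 * n)) m (affineChart i).symm := by
  have h := contMDiffOn_symm_of_mem_maximalAtlas
    (IsManifold.subset_maximalAtlas (I := 𝓡 (2 * n)) (n := m) (M := ComplexProjectiveSpace n)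
      ⟨i, rfl⟩)
  rwa [affineChart_target, contMDiffOn_univ] at h

/-- Homogenisation `ℝ²ⁿ ≅ ℂⁿ → ℂⁿ⁺¹`, `w ↦ (w₀, …, 1, …, w_{n-1})`, is real-analytic (it is
affine-linear). [folklore] -/
theorem contDiff_coe_homogenize_realCoordinates_symm (i : Fin (n + 1)) :
    ContDiff ℝ m fun w : EuclideanSpace ℝ (Fin (2 * n)) ↦
      ((homogenize i ((realCoordinates n).symm w) : {v : Fin (n + 1) → ℂ // v ≠ 0}) :
        Fin (n + 1) → ℂ) := by
  have h : ContDiff ℝ m fun u : Fin n → ℂ ↦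
      ((homogenize i u : {v : Fin (n + 1) → ℂ // v ≠ 0}) : Fin (n + 1) → ℂ) :=
    contDiff_pi.2 fun k ↦ ((contDiff_homogenize_apply i k).restrict_scalars ℝ).of_le le_top
  exact h.comp (realCoordinates n).symm.contDiff

namespace RiemannSphere

/-! #### Elementary lemmas for `ℂℙ¹` and `𝕊²` -/

/-- Homogeneous coordinates of the inverse of the affine chart `0` of `ℂℙ¹`: `c ↦ (1, c)`.
[folklore] -/
theorem coe_homogenize_zero (c : Fin 1 → ℂ) :
    ((homogenize (n := 1) 0 c : {v : Fin 2 → ℂ // v ≠ 0}) : Fin 2 → ℂ) = ![1, c 0] := by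
  funext j
  fin_cases j <;> rfl

/-- Homogeneous coordinates of the inverse of the affine chart `1` of `ℂℙ¹`: `c ↦ (c, 1)`.
[folklore] -/
theorem coe_homogenize_one (c : Fin 1 → ℂ) :
    ((homogenize (n := 1) 1 c : {v : Fin 2 → ℂ // v ≠ 0}) : Fin 2 → ℂ) = ![c 0, 1] := by
  funext j
  fin_cases j <;> rfl

/-- The equation `x² + y² + t² = 1` of the unit sphere of `EuclideanSpace ℝ (Fin 3)`. [folklore] -/
theorem sphere_coord_sq (x : sphere (0 : EuclideanSpace ℝ (Fin 3)) 1) :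
    (x : EuclideanSpace ℝ (Fin 3)) 0 ^ 2 + (x : EuclideanSpace ℝ (Fin 3)) 1 ^ 2 +
      (x : EuclideanSpace ℝ (Fin 3)) 2 ^ 2 = 1 := by
  have h : ‖(x : EuclideanSpace ℝ (Fin 3))‖ ^ 2 = 1 := by rw [norm_eq_of_mem_sphere x, one_pow]
  rwa [EuclideanSpace.real_norm_sq_eq, Fin.sum_univ_three] at h

/-- A complex-valued function with `C^m` real and imaginary parts is `C^m` (over `ℝ`). [folklore] -/
theorem contDiffAt_complex_mk {E' : Type*} [NormedAddCommGroup E'] [NormedSpace ℝ E']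
    {a b : E' → ℝ} {x : E'} (ha : ContDiffAt ℝ m a x) (hb : ContDiffAt ℝ m b x) :
    ContDiffAt ℝ m (fun y ↦ (⟨a y, b y⟩ : ℂ)) x :=
  Complex.equivRealProdCLM.symm.contDiff.contDiffAt.comp x (ha.prodMk hb)

/-! #### The Hopf map in homogeneous coordinates -/

/-- The **Hopf map** `v ↦ (2 Re(v₀ v̄₁), 2 Im(v₀ v̄₁), |v₀|² - |v₁|²) / (|v₀|² + |v₁|²)` on `ℂ²` is
invariant under `v ↦ t • v`, `t ≠ 0` (numerator and denominator are multiplied by `|t|²`), hence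
descends to `ℂℙ¹`. [folklore] -/
theorem hopf_smul (v : Fin 2 → ℂ) {t : ℂ} (ht : t ≠ 0) :
    (‖(t • v) 0‖ ^ 2 + ‖(t • v) 1‖ ^ 2)⁻¹ •
        !₂[2 * ((t • v) 0 * conj ((t • v) 1)).re, 2 * ((t • v) 0 * conj ((t • v) 1)).im,
          ‖(t • v) 0‖ ^ 2 - ‖(t • v) 1‖ ^ 2] =
      (‖v 0‖ ^ 2 + ‖v 1‖ ^ 2)⁻¹ •
        !₂[2 * (v 0 * conj (v 1)).re, 2 * (v 0 * conj (v 1)).im, ‖v 0‖ ^ 2 - ‖v 1‖ ^ 2] := by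
  have key : (t • v) 0 * conj ((t • v) 1) = ((‖t‖ ^ 2 : ℝ) : ℂ) * (v 0 * conj (v 1)) := by
    simp only [Pi.smul_apply, smul_eq_mul, map_mul]
    push_cast
    rw [← Complex.mul_conj']
    ring
  have h0 : ‖(t • v) 0‖ ^ 2 = ‖t‖ ^ 2 * ‖v 0‖ ^ 2 := by simp [mul_pow]
  have h1 : ‖(t • v) 1‖ ^ 2 = ‖t‖ ^ 2 * ‖v 1‖ ^ 2 := by simp [mul_pow]
  have ht' : ‖t‖ ^ 2 ≠ 0 := pow_ne_zero 2 (norm_ne_zero_iff.2 ht)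
  rw [key, h0, h1, Complex.re_ofReal_mul, Complex.im_ofReal_mul]
  ext i
  fin_cases i <;> simp <;> field_simp

/-- The Hopf map takes values on the unit sphere of `ℝ³` (on nonzero vectors):
`4 |v₀ v̄₁|² + (|v₀|² - |v₁|²)² = (|v₀|² + |v₁|²)²`. [folklore] -/
theorem norm_hopf {v : Fin 2 → ℂ} (hv : v ≠ 0) :
    ‖(‖v 0‖ ^ 2 + ‖v 1‖ ^ 2)⁻¹ •
        !₂[2 * (v 0 * conj (v 1)).re, 2 * (v 0 * conj (v 1)).im, ‖v 0‖ ^ 2 - ‖v 1‖ ^ 2]‖ = 1 := by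
  have hN : 0 < ‖v 0‖ ^ 2 + ‖v 1‖ ^ 2 := by
    obtain ⟨i, hi⟩ := Function.ne_iff.1 hv
    fin_cases i
    · exact add_pos_of_pos_of_nonneg (pow_pos (norm_pos_iff.2 hi) 2) (sq_nonneg _)
    · exact add_pos_of_nonneg_of_pos (sq_nonneg _) (pow_pos (norm_pos_iff.2 hi) 2)
  have hsum : ‖!₂[2 * (v 0 * conj (v 1)).re, 2 * (v 0 * conj (v 1)).im, ‖v 0‖ ^ 2 - ‖v 1‖ ^ 2]‖ =
      ‖v 0‖ ^ 2 + ‖v 1‖ ^ 2 := by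
    rw [EuclideanSpace.norm_eq, Fin.sum_univ_three, Real.sqrt_eq_iff_eq_sq _ hN.le]
    · simp only [Matrix.cons_val_zero, Matrix.cons_val_one, Matrix.cons_val_two,
        Matrix.head_cons, Matrix.tail_cons, Real.norm_eq_abs, sq_abs, Complex.sq_norm,
        Complex.normSq_apply, Complex.mul_re, Complex.mul_im, Complex.conj_re, Complex.conj_im]
      ring
    · positivity
  rw [norm_smul, norm_inv, Real.norm_eq_abs, abs_of_pos hN, hsum, inv_mul_cancel₀ hN.ne']

/-- The Hopf map is real-analytic on `ℂ² ∖ {0}` (a rational map whose denominator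
`|v₀|² + |v₁|²` does not vanish there). [folklore] -/
theorem contDiffAt_hopf {v : Fin 2 → ℂ} (hv : v ≠ 0) :
    ContDiffAt ℝ m (fun v : Fin 2 → ℂ ↦ (‖v 0‖ ^ 2 + ‖v 1‖ ^ 2)⁻¹ •
        !₂[2 * (v 0 * conj (v 1)).re, 2 * (v 0 * conj (v 1)).im, ‖v 0‖ ^ 2 - ‖v 1‖ ^ 2]) v := by
  have hN : 0 < ‖v 0‖ ^ 2 + ‖v 1‖ ^ 2 := by
    obtain ⟨i, hi⟩ := Function.ne_iff.1 hv
    fin_cases i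
    · exact add_pos_of_pos_of_nonneg (pow_pos (norm_pos_iff.2 hi) 2) (sq_nonneg _)
    · exact add_pos_of_nonneg_of_pos (sq_nonneg _) (pow_pos (norm_pos_iff.2 hi) 2)
  have hn0 : ContDiff ℝ m fun v : Fin 2 → ℂ ↦ ‖v 0‖ ^ 2 := (contDiff_apply ℝ ℂ 0).norm_sq ℂ
  have hn1 : ContDiff ℝ m fun v : Fin 2 → ℂ ↦ ‖v 1‖ ^ 2 := (contDiff_apply ℝ ℂ 1).norm_sq ℂ
  have ha : ContDiff ℝ m fun v : Fin 2 → ℂ ↦ v 0 * conj (v 1) :=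
    (contDiff_apply ℝ ℂ 0).mul (Complex.conjCLE.contDiff.comp (contDiff_apply ℝ ℂ 1))
  have hre : ContDiff ℝ m fun v : Fin 2 → ℂ ↦ (v 0 * conj (v 1)).re :=
    Complex.reCLM.contDiff.comp ha
  have him : ContDiff ℝ m fun v : Fin 2 → ℂ ↦ (v 0 * conj (v 1)).im :=
    Complex.imCLM.contDiff.comp ha
  refine ((hn0.add hn1).contDiffAt.inv hN.ne').smul (contDiff_euclidean.2 fun i ↦ ?_).contDiffAt
  fin_cases i
  · simpa using contDiff_const.mul hre
  · simpa using contDiff_const.mul him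
  · simpa using hn0.sub hn1

/-! #### The Hopf map on `ℂℙ¹` -/

section Hopf

variable {F : ComplexProjectiveSpace 1 → EuclideanSpace ℝ (Fin 3)}
  (hF : ∀ v : {v : Fin 2 → ℂ // v ≠ 0}, F (mk v) =
    (‖(v : Fin 2 → ℂ) 0‖ ^ 2 + ‖(v : Fin 2 → ℂ) 1‖ ^ 2)⁻¹ •
      !₂[2 * ((v : Fin 2 → ℂ) 0 * conj ((v : Fin 2 → ℂ) 1)).re,
        2 * ((v : Fin 2 → ℂ) 0 * conj ((v : Fin 2 → ℂ) 1)).im,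
        ‖(v : Fin 2 → ℂ) 0‖ ^ 2 - ‖(v : Fin 2 → ℂ) 1‖ ^ 2])
include hF

/-- The Hopf map `F : ℂℙ¹ → ℝ³` is `C^m` for every `m`: in each affine chart it is the Hopf map of
`ℂ² ∖ {0}` precomposed with the (affine-linear) homogenisation. [folklore] -/
theorem contMDiff_of_hopf : ContMDiff (𝓡 (2 * 1)) 𝓘(ℝ, EuclideanSpace ℝ (Fin 3)) m F := by
  refine contMDiff_of_contDiff_comp_affineChart_symm fun i ↦ ?_
  have h : F ∘ (affineChart i).symm = (fun v : Fin 2 → ℂ ↦ (‖v 0‖ ^ 2 + ‖v 1‖ ^ 2)⁻¹ •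
      !₂[2 * (v 0 * conj (v 1)).re, 2 * (v 0 * conj (v 1)).im, ‖v 0‖ ^ 2 - ‖v 1‖ ^ 2]) ∘
      fun w ↦ ((homogenize i ((realCoordinates 1).symm w) : {v : Fin 2 → ℂ // v ≠ 0}) :
        Fin 2 → ℂ) := by
    funext w
    simp only [comp_apply, affineChart_symm_apply, hF]
  rw [h, contDiff_iff_contDiffAt]
  intro w
  exact (contDiffAt_hopf (homogenize i _).2).comp w
    (contDiff_coe_homogenize_realCoordinates_symm i).contDiffAt

/-- The Hopf map `F : ℂℙ¹ → ℝ³` takes values on the unit sphere `𝕊²`. [folklore] -/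
theorem mem_sphere_of_hopf (p : ComplexProjectiveSpace 1) :
    F p ∈ sphere (0 : EuclideanSpace ℝ (Fin 3)) 1 := by
  induction p using ind with
  | h v => rw [mem_sphere_zero_iff_norm, hF]; exact norm_hopf v.2

/-- Right inverse off the south pole: for `(x, y, t) ∈ 𝕊²` with `t ≠ -1`,
`F [1 : (x - iy)/(1 + t)] = (x, y, t)`. [folklore] -/
theorem hopf_affineChart_zero_symm (x : sphere (0 : EuclideanSpace ℝ (Fin 3)) 1)
    (hx : (x : EuclideanSpace ℝ (Fin 3)) 2 ≠ -1) :
    F ((affineChart 0).symm (realCoordinates 1 fun _ ↦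
      ⟨(x : EuclideanSpace ℝ (Fin 3)) 0 / (1 + (x : EuclideanSpace ℝ (Fin 3)) 2),
        -(x : EuclideanSpace ℝ (Fin 3)) 1 / (1 + (x : EuclideanSpace ℝ (Fin 3)) 2)⟩)) = x := by
  have hs := sphere_coord_sq x
  have h1 : 1 + (x : EuclideanSpace ℝ (Fin 3)) 2 ≠ 0 := fun h ↦ hx (by linarith)
  rw [affineChart_symm_apply, ContinuousLinearEquiv.symm_apply_apply, hF, coe_homogenize_zero]
  ext i
  fin_cases i
  · simp [Complex.sq_norm, Complex.normSq_apply]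
    field_simp
    linear_combination (-(x : EuclideanSpace ℝ (Fin 3)) 0) * hs
  · simp [Complex.sq_norm, Complex.normSq_apply]
    field_simp
    linear_combination (-(x : EuclideanSpace ℝ (Fin 3)) 1) * hs
  · simp [Complex.sq_norm, Complex.normSq_apply]
    field_simp
    linear_combination (-(1 + (x : EuclideanSpace ℝ (Fin 3)) 2)) * hs

/-- Right inverse off the north pole: for `(x, y, t) ∈ 𝕊²` with `t ≠ 1`,
`F [(x + iy)/(1 - t) : 1] = (x, y, t)`. [folklore] -/
theorem hopf_affineChart_one_symm (x : sphere (0 : EuclideanSpace ℝ (Fin 3)) 1)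
    (hx : (x : EuclideanSpace ℝ (Fin 3)) 2 ≠ 1) :
    F ((affineChart 1).symm (realCoordinates 1 fun _ ↦
      ⟨(x : EuclideanSpace ℝ (Fin 3)) 0 / (1 - (x : EuclideanSpace ℝ (Fin 3)) 2),
        (x : EuclideanSpace ℝ (Fin 3)) 1 / (1 - (x : EuclideanSpace ℝ (Fin 3)) 2)⟩)) = x := by
  have hs := sphere_coord_sq x
  have h1 : 1 - (x : EuclideanSpace ℝ (Fin 3)) 2 ≠ 0 := sub_ne_zero.2 (Ne.symm hx)
  rw [affineChart_symm_apply, ContinuousLinearEquiv.symm_apply_apply, hF, coe_homogenize_one]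
  ext i
  fin_cases i
  · simp [Complex.sq_norm, Complex.normSq_apply]
    field_simp
    linear_combination (-(x : EuclideanSpace ℝ (Fin 3)) 0) * hs
  · simp [Complex.sq_norm, Complex.normSq_apply]
    field_simp
    linear_combination (-(x : EuclideanSpace ℝ (Fin 3)) 1) * hs
  · simp [Complex.sq_norm, Complex.normSq_apply]
    field_simp
    linear_combination (1 - (x : EuclideanSpace ℝ (Fin 3)) 2) * hs

/-- Left inverse at the point `[0 : 1]`: it is mapped by `F` to the south pole `(0, 0, -1)`, and
`[(x + iy)/(1 - t) : 1] = [0 : 1]` there. [folklore] -/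
theorem inv_hopf_hopf_of_eq_zero (v : {v : Fin 2 → ℂ // v ≠ 0}) (hv : (v : Fin 2 → ℂ) 0 = 0) :
    F (mk v) 2 = -1 ∧
      (affineChart 1).symm (realCoordinates 1 fun _ ↦
        ⟨F (mk v) 0 / (1 - F (mk v) 2), F (mk v) 1 / (1 - F (mk v) 2)⟩) = mk v := by
  have hv1 : (v : Fin 2 → ℂ) 1 ≠ 0 := by
    intro h
    apply v.2
    funext j
    fin_cases j
    · exact hv
    · exact h
  have hn : ‖(v : Fin 2 → ℂ) 1‖ ^ 2 ≠ 0 := pow_ne_zero 2 (norm_ne_zero_iff.2 hv1)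
  have h2 : F (mk v) 2 = -1 := by
    rw [hF]
    simp [hv, hn]
  have h0 : F (mk v) 0 = 0 := by rw [hF]; simp [hv]
  have h1 : F (mk v) 1 = 0 := by rw [hF]; simp [hv]
  refine ⟨h2, ?_⟩
  rw [h0, h1, h2, affineChart_symm_apply, ContinuousLinearEquiv.symm_apply_apply, eq_comm,
    mk_eq_mk_iff]
  refine ⟨(v : Fin 2 → ℂ) 1, ?_⟩
  rw [coe_homogenize_one]
  funext j
  fin_cases j
  · simp [hv, Complex.ext_iff]
  · simp

/-- Left inverse at the points `[v₀ : v₁]`, `v₀ ≠ 0`: `F [v₀ : v₁] = (x, y, t)` has `t ≠ -1` and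
`[1 : (x - iy)/(1 + t)] = [v₀ : v₁]`, because `v₀ (x - iy)/(1 + t) = v₀ v̄₀ v₁ / |v₀|² = v₁`.
[folklore] -/
theorem inv_hopf_hopf_of_ne_zero (v : {v : Fin 2 → ℂ // v ≠ 0}) (hv : (v : Fin 2 → ℂ) 0 ≠ 0) :
    F (mk v) 2 ≠ -1 ∧
      (affineChart 0).symm (realCoordinates 1 fun _ ↦
        ⟨F (mk v) 0 / (1 + F (mk v) 2), -F (mk v) 1 / (1 + F (mk v) 2)⟩) = mk v := by
  have hn0 : 0 < ‖(v : Fin 2 → ℂ) 0‖ ^ 2 := pow_pos (norm_pos_iff.2 hv) 2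
  have hN : 0 < ‖(v : Fin 2 → ℂ) 0‖ ^ 2 + ‖(v : Fin 2 → ℂ) 1‖ ^ 2 :=
    add_pos_of_pos_of_nonneg hn0 (sq_nonneg _)
  have h2 : 1 + F (mk v) 2 =
      2 * ‖(v : Fin 2 → ℂ) 0‖ ^ 2 / (‖(v : Fin 2 → ℂ) 0‖ ^ 2 + ‖(v : Fin 2 → ℂ) 1‖ ^ 2) := by
    rw [hF]
    simp
    field_simp
    ring
  have h2' : 1 + F (mk v) 2 ≠ 0 := by
    rw [h2]; positivity
  refine ⟨fun h ↦ h2' (by rw [h]; norm_num), ?_⟩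
  rw [affineChart_symm_apply, ContinuousLinearEquiv.symm_apply_apply, eq_comm, mk_eq_mk_iff]
  refine ⟨(v : Fin 2 → ℂ) 0, ?_⟩
  rw [coe_homogenize_zero]
  funext j
  fin_cases j
  · simp
  · simp only [Pi.smul_apply, smul_eq_mul]
    rw [h2, hF]
    have hA : ‖(v : Fin 2 → ℂ) 0‖ ^ 2 ≠ 0 := hn0.ne'
    have hAB : ‖(v : Fin 2 → ℂ) 0‖ ^ 2 + ‖(v : Fin 2 → ℂ) 1‖ ^ 2 ≠ 0 := hN.ne'
    apply Complex.ext
    · simp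
      field_simp
      simp only [Complex.sq_norm, Complex.normSq_apply]
      ring
    · simp
      field_simp
      simp only [Complex.sq_norm, Complex.normSq_apply]
      ring

end Hopf

/-! #### The inverse map `𝕊² → ℂℙ¹` -/

/-- The two branches of the inverse map agree away from the poles: for `(x, y, t) ∈ 𝕊²` with
`t ≠ ±1`, `[1 : (x - iy)/(1 + t)] = [(x + iy)/(1 - t) : 1]` in `ℂℙ¹`, because
`(x - iy)(x + iy) = x² + y² = (1 + t)(1 - t)`. [folklore] -/
theorem affineChart_zero_symm_eq_one_symm (x : sphere (0 : EuclideanSpace ℝ (Fin 3)) 1)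
    (h₁ : (x : EuclideanSpace ℝ (Fin 3)) 2 ≠ 1) (h₂ : (x : EuclideanSpace ℝ (Fin 3)) 2 ≠ -1) :
    (affineChart 0).symm (realCoordinates 1 fun _ ↦
      (⟨(x : EuclideanSpace ℝ (Fin 3)) 0 / (1 + (x : EuclideanSpace ℝ (Fin 3)) 2),
        -(x : EuclideanSpace ℝ (Fin 3)) 1 / (1 + (x : EuclideanSpace ℝ (Fin 3)) 2)⟩ : ℂ)) =
    (affineChart 1).symm (realCoordinates 1 fun _ ↦
      (⟨(x : EuclideanSpace ℝ (Fin 3)) 0 / (1 - (x : EuclideanSpace ℝ (Fin 3)) 2),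
        (x : EuclideanSpace ℝ (Fin 3)) 1 / (1 - (x : EuclideanSpace ℝ (Fin 3)) 2)⟩ : ℂ)) := by
  have hs := sphere_coord_sq x
  have h1 : 1 - (x : EuclideanSpace ℝ (Fin 3)) 2 ≠ 0 := sub_ne_zero.2 (Ne.symm h₁)
  have h2 : 1 + (x : EuclideanSpace ℝ (Fin 3)) 2 ≠ 0 := fun h ↦ h₂ (by linarith)
  simp only [affineChart_symm_apply, ContinuousLinearEquiv.symm_apply_apply]
  rw [mk_eq_mk_iff]
  refine ⟨⟨(x : EuclideanSpace ℝ (Fin 3)) 0 / (1 + (x : EuclideanSpace ℝ (Fin 3)) 2),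
    -(x : EuclideanSpace ℝ (Fin 3)) 1 / (1 + (x : EuclideanSpace ℝ (Fin 3)) 2)⟩, ?_⟩
  rw [coe_homogenize_zero, coe_homogenize_one]
  funext j
  fin_cases j
  · simp only [Pi.smul_apply, smul_eq_mul]
    apply Complex.ext
    · simp
      field_simp
      linear_combination hs
    · simp
      field_simp
      ring
  · simp

section InvHopf

variable {g : sphere (0 : EuclideanSpace ℝ (Fin 3)) 1 → ComplexProjectiveSpace 1}
  (hg : ∀ x, g x = if (x : EuclideanSpace ℝ (Fin 3)) 2 = -1 then
      (affineChart 1).symm (realCoordinates 1 fun _ ↦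
        (⟨(x : EuclideanSpace ℝ (Fin 3)) 0 / (1 - (x : EuclideanSpace ℝ (Fin 3)) 2),
          (x : EuclideanSpace ℝ (Fin 3)) 1 / (1 - (x : EuclideanSpace ℝ (Fin 3)) 2)⟩ : ℂ))
    else
      (affineChart 0).symm (realCoordinates 1 fun _ ↦
        (⟨(x : EuclideanSpace ℝ (Fin 3)) 0 / (1 + (x : EuclideanSpace ℝ (Fin 3)) 2),
          -(x : EuclideanSpace ℝ (Fin 3)) 1 / (1 + (x : EuclideanSpace ℝ (Fin 3)) 2)⟩ : ℂ)))
include hg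

/-- Off the south pole the inverse map is `(x, y, t) ↦ [1 : (x - iy)/(1 + t)]`. [folklore] -/
theorem invHopf_eq_of_ne_neg_one (x : sphere (0 : EuclideanSpace ℝ (Fin 3)) 1)
    (hx : (x : EuclideanSpace ℝ (Fin 3)) 2 ≠ -1) :
    g x = (affineChart 0).symm (realCoordinates 1 fun _ ↦
        (⟨(x : EuclideanSpace ℝ (Fin 3)) 0 / (1 + (x : EuclideanSpace ℝ (Fin 3)) 2),
          -(x : EuclideanSpace ℝ (Fin 3)) 1 / (1 + (x : EuclideanSpace ℝ (Fin 3)) 2)⟩ : ℂ)) := by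
  rw [hg, if_neg hx]

/-- Off the north pole the inverse map is `(x, y, t) ↦ [(x + iy)/(1 - t) : 1]`. [folklore] -/
theorem invHopf_eq_of_ne_one (x : sphere (0 : EuclideanSpace ℝ (Fin 3)) 1)
    (hx : (x : EuclideanSpace ℝ (Fin 3)) 2 ≠ 1) :
    g x = (affineChart 1).symm (realCoordinates 1 fun _ ↦
        (⟨(x : EuclideanSpace ℝ (Fin 3)) 0 / (1 - (x : EuclideanSpace ℝ (Fin 3)) 2),
          (x : EuclideanSpace ℝ (Fin 3)) 1 / (1 - (x : EuclideanSpace ℝ (Fin 3)) 2)⟩ : ℂ)) := by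
  rw [hg]
  split_ifs with h
  · rfl
  · exact affineChart_zero_symm_eq_one_symm x hx h

/-- The inverse map `g : 𝕊² → ℂℙ¹` is `C^m` for every `m`: near each point it is an inverse
affine chart of `ℂℙ¹` after a rational map of `ℝ³` (regular near the point) restricted to the
sphere. [folklore] -/
theorem contMDiff_invHopf : ContMDiff (𝓡 2) (𝓡 (2 * 1)) m g := by
  haveI := Fact.mk (@finrank_euclideanSpace_fin ℝ _ (2 + 1))
  intro x
  by_cases hx : (x : EuclideanSpace ℝ (Fin 3)) 2 = -1
  · have hx' : (x : EuclideanSpace ℝ (Fin 3)) 2 ≠ 1 := by rw [hx]; norm_num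
    have h1 : 1 - (x : EuclideanSpace ℝ (Fin 3)) 2 ≠ 0 := sub_ne_zero.2 (Ne.symm hx')
    have ho : IsOpen {y : sphere (0 : EuclideanSpace ℝ (Fin 3)) 1 |
        (y : EuclideanSpace ℝ (Fin 3)) 2 ≠ 1} :=
      isOpen_ne_fun (by fun_prop) continuous_const
    have hev : g =ᶠ[𝓝 x] (affineChart 1).symm ∘ (fun p : EuclideanSpace ℝ (Fin 3) ↦
        realCoordinates 1 fun _ ↦ (⟨p 0 / (1 - p 2), p 1 / (1 - p 2)⟩ : ℂ)) ∘ Subtype.val := by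
      filter_upwards [ho.mem_nhds hx'] with y hy
      exact invHopf_eq_of_ne_one hg y hy
    refine ContMDiffAt.congr_of_eventuallyEq ?_ hev
    refine (contMDiff_affineChart_symm 1).contMDiffAt.comp x ?_
    refine ContMDiffAt.comp x (ContDiffAt.contMDiffAt ?_) contMDiff_coe_sphere.contMDiffAt
    refine (realCoordinates 1).contDiff.contDiffAt.comp _ (contDiffAt_pi.2 fun _ ↦ ?_)
    exact contDiffAt_complex_mk (by fun_prop (disch := exact h1)) (by fun_prop (disch := exact h1))
  · have h1 : 1 + (x : EuclideanSpace ℝ (Fin 3)) 2 ≠ 0 := fun h ↦ hx (by linarith)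
    have ho : IsOpen {y : sphere (0 : EuclideanSpace ℝ (Fin 3)) 1 |
        (y : EuclideanSpace ℝ (Fin 3)) 2 ≠ -1} :=
      isOpen_ne_fun (by fun_prop) continuous_const
    have hev : g =ᶠ[𝓝 x] (affineChart 0).symm ∘ (fun p : EuclideanSpace ℝ (Fin 3) ↦
        realCoordinates 1 fun _ ↦ (⟨p 0 / (1 + p 2), -p 1 / (1 + p 2)⟩ : ℂ)) ∘ Subtype.val := by
      filter_upwards [ho.mem_nhds hx] with y hy
      exact invHopf_eq_of_ne_neg_one hg y hy
    refine ContMDiffAt.congr_of_eventuallyEq ?_ hev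
    refine (contMDiff_affineChart_symm 0).contMDiffAt.comp x ?_
    refine ContMDiffAt.comp x (ContDiffAt.contMDiffAt ?_) contMDiff_coe_sphere.contMDiffAt
    refine (realCoordinates 1).contDiff.contDiffAt.comp _ (contDiffAt_pi.2 fun _ ↦ ?_)
    exact contDiffAt_complex_mk (by fun_prop (disch := exact h1)) (by fun_prop (disch := exact h1))

variable {F : ComplexProjectiveSpace 1 → EuclideanSpace ℝ (Fin 3)}
  (hF : ∀ v : {v : Fin 2 → ℂ // v ≠ 0}, F (mk v) =
    (‖(v : Fin 2 → ℂ) 0‖ ^ 2 + ‖(v : Fin 2 → ℂ) 1‖ ^ 2)⁻¹ •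
      !₂[2 * ((v : Fin 2 → ℂ) 0 * conj ((v : Fin 2 → ℂ) 1)).re,
        2 * ((v : Fin 2 → ℂ) 0 * conj ((v : Fin 2 → ℂ) 1)).im,
        ‖(v : Fin 2 → ℂ) 0‖ ^ 2 - ‖(v : Fin 2 → ℂ) 1‖ ^ 2])
include hF

/-- `F ∘ g = id` on `𝕊²`. [folklore] -/
theorem hopf_invHopf (x : sphere (0 : EuclideanSpace ℝ (Fin 3)) 1) : F (g x) = x := by
  by_cases hx : (x : EuclideanSpace ℝ (Fin 3)) 2 = -1
  · have hx' : (x : EuclideanSpace ℝ (Fin 3)) 2 ≠ 1 := by rw [hx]; norm_num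
    rw [invHopf_eq_of_ne_one hg x hx']
    exact hopf_affineChart_one_symm hF x hx'
  · rw [invHopf_eq_of_ne_neg_one hg x hx]
    exact hopf_affineChart_zero_symm hF x hx

/-- `g ∘ f = id` on `ℂℙ¹`, for the corestriction `f : ℂℙ¹ → 𝕊²` of `F`. [folklore] -/
theorem invHopf_hopf {f : ComplexProjectiveSpace 1 → sphere (0 : EuclideanSpace ℝ (Fin 3)) 1}
    (hf : ∀ p, (f p : EuclideanSpace ℝ (Fin 3)) = F p) (p : ComplexProjectiveSpace 1) :
    g (f p) = p := by
  induction p using ind with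
  | h v =>
    rw [hg, hf]
    by_cases hv : (v : Fin 2 → ℂ) 0 = 0
    · obtain ⟨h2, h⟩ := inv_hopf_hopf_of_eq_zero hF v hv
      rw [if_pos h2, h]
    · obtain ⟨h2, h⟩ := inv_hopf_hopf_of_ne_zero hF v hv
      rw [if_neg h2, h]

end InvHopf

end RiemannSphere

end ComplexProjectiveSpace

open ComplexProjectiveSpace ComplexProjectiveSpace.RiemannSphere in
/-- **`ℂℙ¹` is diffeomorphic to the `2`-sphere**: discharge of the named fact
`Literature.Topology.FourManifolds.nonempty_diffeomorph_complexProjectiveSpace_one_sphere`, witnessed by the Hopf map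
`[v₀ : v₁] ↦ (2 v₀ v̄₁, |v₀|² - |v₁|²) / (|v₀|² + |v₁|²) ∈ ℂ × ℝ = ℝ³` with inverse
`(x, y, t) ↦ [1 + t : x - iy] = [x + iy : 1 - t]` (Griffiths–Harris, *Principles of Algebraic
Geometry*, Ch. 0 §2: `ℙ¹` is the Riemann sphere `ℂ ∪ {∞} = S²`; Milnor–Stasheff, §14).
[cite: GriffithsHarrisPrinciples1978, Ch. 0 §2 (ℂℙ¹ is the Riemann sphere)] -/
theorem nonempty_diffeomorph_complexProjectiveSpace_one_sphere_holds :
    nonempty_diffeomorph_complexProjectiveSpace_one_sphere := by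
  haveI := Fact.mk (@finrank_euclideanSpace_fin ℝ _ (2 + 1))
  -- the Hopf map `ℂℙ¹ → ℝ³`
  let F : ComplexProjectiveSpace 1 → EuclideanSpace ℝ (Fin 3) :=
    Projectivization.lift
      (fun v ↦ (‖(v : Fin 2 → ℂ) 0‖ ^ 2 + ‖(v : Fin 2 → ℂ) 1‖ ^ 2)⁻¹ •
        !₂[2 * ((v : Fin 2 → ℂ) 0 * conj ((v : Fin 2 → ℂ) 1)).re,
          2 * ((v : Fin 2 → ℂ) 0 * conj ((v : Fin 2 → ℂ) 1)).im,
          ‖(v : Fin 2 → ℂ) 0‖ ^ 2 - ‖(v : Fin 2 → ℂ) 1‖ ^ 2])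
      (by
        rintro a b t h
        have ht : t ≠ 0 := by rintro rfl; exact a.2 (by simpa using h)
        simp only [h]
        exact hopf_smul _ ht)
  have hF : ∀ v : {v : Fin 2 → ℂ // v ≠ 0}, F (mk v) =
      (‖(v : Fin 2 → ℂ) 0‖ ^ 2 + ‖(v : Fin 2 → ℂ) 1‖ ^ 2)⁻¹ •
        !₂[2 * ((v : Fin 2 → ℂ) 0 * conj ((v : Fin 2 → ℂ) 1)).re,
          2 * ((v : Fin 2 → ℂ) 0 * conj ((v : Fin 2 → ℂ) 1)).im,
          ‖(v : Fin 2 → ℂ) 0‖ ^ 2 - ‖(v : Fin 2 → ℂ) 1‖ ^ 2] := fun v ↦ rfl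
  have hFs : ∀ p, F p ∈ sphere (0 : EuclideanSpace ℝ (Fin 3)) 1 := mem_sphere_of_hopf hF
  -- its corestriction `ℂℙ¹ → 𝕊²`
  let f : ComplexProjectiveSpace 1 → sphere (0 : EuclideanSpace ℝ (Fin 3)) 1 :=
    Set.codRestrict F _ hFs
  have hf : ∀ p, (f p : EuclideanSpace ℝ (Fin 3)) = F p := fun p ↦ rfl
  -- the inverse `𝕊² → ℂℙ¹`
  let g : sphere (0 : EuclideanSpace ℝ (Fin 3)) 1 → ComplexProjectiveSpace 1 := fun x ↦
    if (x : EuclideanSpace ℝ (Fin 3)) 2 = -1 then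
      (affineChart 1).symm (realCoordinates 1 fun _ ↦
        (⟨(x : EuclideanSpace ℝ (Fin 3)) 0 / (1 - (x : EuclideanSpace ℝ (Fin 3)) 2),
          (x : EuclideanSpace ℝ (Fin 3)) 1 / (1 - (x : EuclideanSpace ℝ (Fin 3)) 2)⟩ : ℂ))
    else
      (affineChart 0).symm (realCoordinates 1 fun _ ↦
        (⟨(x : EuclideanSpace ℝ (Fin 3)) 0 / (1 + (x : EuclideanSpace ℝ (Fin 3)) 2),
          -(x : EuclideanSpace ℝ (Fin 3)) 1 / (1 + (x : EuclideanSpace ℝ (Fin 3)) 2)⟩ : ℂ))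
  have hg : ∀ x, g x = if (x : EuclideanSpace ℝ (Fin 3)) 2 = -1 then
      (affineChart 1).symm (realCoordinates 1 fun _ ↦
        (⟨(x : EuclideanSpace ℝ (Fin 3)) 0 / (1 - (x : EuclideanSpace ℝ (Fin 3)) 2),
          (x : EuclideanSpace ℝ (Fin 3)) 1 / (1 - (x : EuclideanSpace ℝ (Fin 3)) 2)⟩ : ℂ))
    else
      (affineChart 0).symm (realCoordinates 1 fun _ ↦
        (⟨(x : EuclideanSpace ℝ (Fin 3)) 0 / (1 + (x : EuclideanSpace ℝ (Fin 3)) 2),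
          -(x : EuclideanSpace ℝ (Fin 3)) 1 / (1 + (x : EuclideanSpace ℝ (Fin 3)) 2)⟩ : ℂ)) :=
    fun x ↦ rfl
  have hfg : ∀ x, f (g x) = x := fun x ↦ Subtype.ext (by rw [hf]; exact hopf_invHopf hg hF x)
  exact ⟨{ toFun := f
           invFun := g
           left_inv := invHopf_hopf hg hF hf
           right_inv := hfg
           contMDiff_toFun := (contMDiff_of_hopf hF).codRestrict_sphere hFs
           contMDiff_invFun := contMDiff_invHopf hg }⟩

/-! ### Simple connectivity of `ℂℙⁿ`

Source: J. Milnor, J. Stasheff, *Characteristic Classes*, Ann. of Math. Studies 76 (1974), §14,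
Thm. 14.4 (`ℂℙⁿ` is a CW complex with one cell `e²ᵏ` in each even dimension `2k ≤ 2n`), whence
`π₁(ℂℙⁿ) = 1` (the `1`-skeleton is a point); the same cell structure is Hatcher, *Algebraic
Topology* (2002), Example 0.6. The proof formalised here is the elementary one through the
affine cover: Hatcher, Lemma 1.15 (if `X = ⋃ A_α` with the `A_α` open, path connected, all
containing `x₀`, and all `A_α ∩ A_β` path connected, then every loop at `x₀` is a product of loops
each inside one `A_α`), in the tree as `Literature.AlgebraicTopology.FundamentalGroup.simplyConnectedSpace_of_isOpen_cover`
(`Literature/AlgebraicTopology/FundamentalGroup/SphereSimplyConnected.lean`), applied to the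
`n + 1` chart domains `Uᵢ = {[v] | vᵢ ≠ 0} ≅ ℝ²ⁿ` (Hatcher, §3.3), which are simply connected,
all contain `[1 : ⋯ : 1]`, and have path-connected pairwise intersections
`Uᵢ ∩ Uⱼ = {vᵢ ≠ 0, vⱼ ≠ 0}` (image of a product of lines and punctured lines of `ℂⁿ⁺¹`). -/

namespace ComplexProjectiveSpace

variable {n : ℕ}

/-- The domain `Uᵢ = {[v] | vᵢ ≠ 0}` of the `i`-th affine chart of `ℂℙⁿ` is simply connected: the
chart is a homeomorphism onto the whole model space `ℝ²ⁿ`, which is contractible (Hatcher,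
*Algebraic Topology*, §3.3: `ℂℙⁿ` has an open cover by the sets `Uᵢ`, homeomorphic to `ℝ²ⁿ`).
[folklore] -/
theorem isSimplyConnected_setOf_coordNeZero (i : Fin (n + 1)) :
    IsSimplyConnected {p : ComplexProjectiveSpace n | CoordNeZero i p} := by
  have e : (affineChart i).source ≃ₜ EuclideanSpace ℝ (Fin (2 * n)) :=
    (affineChart i).toHomeomorphSourceTarget.trans
      ((Homeomorph.setCongr (affineChart_target i)).trans (Homeomorph.Set.univ _))
  exact e.toHomotopyEquiv.simplyConnectedSpace

/-- The overlap `Uᵢ ∩ Uⱼ = {[v] | vᵢ ≠ 0, vⱼ ≠ 0}` of two affine chart domains of `ℂℙⁿ` is path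
connected: it is the image under the quotient map of `{v ∈ ℂⁿ⁺¹ | vᵢ ≠ 0, vⱼ ≠ 0}`, a product of
copies of `ℂ` and of the path-connected punctured line `ℂ ∖ {0}`. [folklore] -/
theorem isPathConnected_setOf_coordNeZero_inter (i j : Fin (n + 1)) :
    IsPathConnected
      ({p : ComplexProjectiveSpace n | CoordNeZero i p} ∩ {p | CoordNeZero j p}) := by
  -- the factors of the product set `{v | vᵢ ≠ 0, vⱼ ≠ 0} ⊆ ℂⁿ⁺¹`
  set s : Fin (n + 1) → Set ℂ := fun k ↦ if k = i ∨ k = j then {0}ᶜ else univ with hs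
  have hsk : ∀ k, IsPathConnected (s k) := by
    intro k
    by_cases hk : k = i ∨ k = j
    · simp only [hs, hk, if_true]
      refine isPathConnected_compl_singleton_of_one_lt_rank ?_ 0
      rw [← Module.finrank_eq_rank, Complex.finrank_real_complex]
      norm_num
    · simp only [hs, hk, if_false]
      exact isPathConnected_univ
  have hT : IsPathConnected (univ.pi s) := IsPathConnected.pi hsk
  have hTsub : univ.pi s ⊆ {v : Fin (n + 1) → ℂ | v ≠ 0} := by
    intro v hv h0
    have := (mem_univ_pi.mp hv) i
    simp [hs, h0] at this
  have hT' := (hT.preimage_coe hTsub).image (f := mk) continuous_mk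
  convert hT' using 1
  ext p
  constructor
  · intro hp
    induction p using ind with
    | h v =>
      obtain ⟨hi, hj⟩ := hp
      replace hi : (v : Fin (n + 1) → ℂ) i ≠ 0 := hi
      replace hj : (v : Fin (n + 1) → ℂ) j ≠ 0 := hj
      refine ⟨v, mem_preimage.mpr (mem_univ_pi.mpr fun k ↦ ?_), rfl⟩
      by_cases hk : k = i ∨ k = j
      · have hvk : (v : Fin (n + 1) → ℂ) k ≠ 0 := by
          rcases hk with rfl | rfl
          exacts [hi, hj]
        simp [hs, hk, hvk]
      · simp [hs, hk]
  · rintro ⟨w, hw, rfl⟩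
    have hw' : ∀ k, k = i ∨ k = j → (w : Fin (n + 1) → ℂ) k ≠ 0 := fun k hk ↦ by
      have := (mem_univ_pi.mp (mem_preimage.mp hw)) k
      simpa [hs, hk] using this
    exact ⟨hw' i (Or.inl rfl), hw' j (Or.inr rfl)⟩

end ComplexProjectiveSpace

open ComplexProjectiveSpace in
/-- **`ℂℙⁿ` is simply connected**: discharge of the named fact
`Literature.Topology.FourManifolds.simplyConnectedSpace_complexProjectiveSpace` (Milnor–Stasheff, *Characteristic Classes*,
§14, Thm. 14.4: `ℂℙⁿ` is a CW complex with one cell in each even dimension `≤ 2n`, whence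
`π₁ = 1`; Hatcher, *Algebraic Topology*, Example 0.6). Proof formalised: the elementary route
through Hatcher's Lemma 1.15 (van Kampen with trivial groups,
`Literature.AlgebraicTopology.FundamentalGroup.simplyConnectedSpace_of_isOpen_cover`) applied to the cover of `ℂℙⁿ` by the `n + 1`
affine chart domains `Uᵢ = {zᵢ ≠ 0} ≅ ℝ²ⁿ` (Hatcher, §3.3), which are open, simply connected
(`isSimplyConnected_setOf_coordNeZero`), all contain `[1 : ⋯ : 1]`, and meet pairwise in the
path-connected sets `Uᵢ ∩ Uⱼ` (`isPathConnected_setOf_coordNeZero_inter`).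
[cite: MilnorStasheffAMS76, §14 (Thm. 14.4 ff.: CW structure with even cells)] -/
theorem simplyConnectedSpace_complexProjectiveSpace_holds :
    simplyConnectedSpace_complexProjectiveSpace := by
  intro n
  refine Literature.AlgebraicTopology.FundamentalGroup.simplyConnectedSpace_of_isOpen_cover
    (c := fun i : Fin (n + 1) ↦ {p : ComplexProjectiveSpace n | CoordNeZero i p})
    isOpen_setOf_coordNeZero (iUnion_eq_univ_iff.mpr exists_coordNeZero)
    isSimplyConnected_setOf_coordNeZero isPathConnected_setOf_coordNeZero_inter
    (x₀ := mk ⟨fun _ ↦ 1, by simp [funext_iff]⟩) fun i ↦ ?_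
  exact one_ne_zero

/-- **`ℂℙ²` is simply connected**: discharge of the named fact
`Literature.Topology.FourManifolds.simplyConnectedSpace_complexProjectivePlane`, the case `n = 2` of
`simplyConnectedSpace_complexProjectiveSpace_holds` (Milnor–Stasheff, *Characteristic Classes*,
§14, Thm. 14.4). [cite: MilnorStasheffAMS76, §14 (Thm. 14.4 ff.: CW structure with even cells)] -/
theorem simplyConnectedSpace_complexProjectivePlane_holds :
    simplyConnectedSpace_complexProjectivePlane :=
  simplyConnectedSpace_complexProjectiveSpace_holds 2

end Literature.Topology.FourManifolds
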